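import Literature.Geometry.Lorentzian.ConformalChangeFour
import Literature.Geometry.Lorentzian.CurvatureNaturality
import Literature.Geometry.Lorentzian.DalembertianNaturality
import Literature.Geometry.Lorentzian.EndChartIntegral
import HarnessLib

/-!
# The Ricci tensor, scalar curvature, trace-free Ricci and Weyl–Schouten tensors of a conformal
# metric `e^{2w} g` on a manifold (Besse 1987, Thm. 1.159 (d)–(f); Chang–Gursky–Yang 2003, §1)

Topic `Geometry/Lorentzian` (pseudo-Riemannian metrics of any signature; the conformal calculus
of `ConformalCoordCurvature.lean`, `ConformalChangeFour.lean`). Sixth companion file of the named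
fact `Literature.Geometry.Riemannian.changGurskyYang_sphere_four` (Chang–Gursky–Yang 2003,
Thm. A): the last analytic hypothesis of its reductions is Thm. 1.4 of the paper, an existence
theorem for the fully nonlinear equation (1.20) `σ₂(A_g) − (α/4)|W_g|² = f` in a conformal class
`g = e^{2w} g₀`, whose very formulation as a PDE for `w` ((1.26)–(1.27), `M_{ij}(w) = 2S⁰_{ij} +
2∇⁰ᵢ∇⁰ⱼw − 2Δ₀w g⁰ᵢⱼ − 2∇⁰ᵢw∇⁰ⱼw`, `S = −Ric + ½Rg`) rests on the transformation law of the
Weyl–Schouten tensor `A = Ric − (1/6) R g` (p. 110) under `g = e^{2w} g₀`: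
`A_g = A₀ − 2∇₀²w + 2 dw ⊗ dw − |∇₀w|² g₀`. The tree had the conformal laws of the full
curvature tensor (Besse 1.159 (b): `MetricCoord.IsMetricOn.apply_riemAt_conformal`,
`PseudoRiemannianMetric.curvatureForm_conformal`), of the Ricci tensor and scalar curvature IN
COORDINATES (`IsMetricOn.ricAt_conformal`, `scalAt_conformal`, with the abstract form `θ = dc/2c`,
`H = ∇θ`), of the Weyl tensor, and ON MANIFOLDS only the scalar curvature laws for `ψ² g`
(`n = 4`) and `ψ⁴ g` (`n = 3`). This file proves, on a manifold `X` modelled on its model vector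
space `E` (`dim E = n`, charts into `E`), for `C^∞` metrics `g`, `g' = e^{2w} g` with their
Levi-Civita connections and `w ∈ C^∞(X)`, in the tree's intrinsic vocabulary (`ricci`,
`scalarCurvature`, `hessian`, `dalembertian = tr_g Hess`, `innerDual = g⁻¹` on covectors,
`mvfderiv = d`):

* `MetricCoord.confForm_exp`, `IsMetricOn.confHess_exp` — for `c = e^{2u}`: `θ = du`,
  `H = Hess_G u` (`hessAt`); `IsMetricOn.ricAt_conformal_exp`, `IsMetricOn.scalAt_conformal_exp` —
  Besse 1.159 (d), (f) in coordinates with the coordinate Hessian/Laplacian of `u`;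
* `OpensChart.ricci_conformalRepr_exp`, `OpensChart.scalarCurvature_conformalRepr_exp` — the
  same for the abstract tensors of metrics on an open subset of `E` (dictionary
  `ChartMetricCoord.lean`);
* **`PseudoRiemannianMetric.ricci_conformal_exp`** (Besse 1987, 1.159 (d), verbatim up to the
  sign convention `Δ_tree = −Δ_Besse`):
  `Ric'(Y,Z) = Ric(Y,Z) − (n−2)(Hess w (Y,Z) − dw(Y)dw(Z)) − (Δw + (n−2) g⁻¹(dw,dw)) g(Y,Z)`;
* **`PseudoRiemannianMetric.scalarCurvature_conformal_exp`** (1.159 (f)):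
  `R' = e^{−2w}(R − 2(n−1)Δw − (n−2)(n−1) g⁻¹(dw,dw))`;
* **`PseudoRiemannianMetric.tracelessRicciForm_conformal_exp`** (1.159 (e)):
  `Z' = Z − (n−2)(Hess w − dw⊗dw) + ((n−2)/n)(Δw − |dw|²) g`, `Z = Ric − (R/n) g`;
* in dimension four: `ricci_conformal_exp_four`, `scalarCurvature_conformal_exp_four`
  (`R' = e^{−2w}(R − 6Δw − 6|dw|²)`), `tracelessRicciForm_conformal_exp_four`
  (`E' = E − 2(Hess w − dw⊗dw) + ½(Δw − |dw|²) g`, `E = Ric − ¼Rg` of Chang–Gursky–Yang's (0.1))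
  and **`weylSchouten_conformal_exp_four`**:
  `A'(Y,Z) = A(Y,Z) − 2 Hess w (Y,Z) + 2 dw(Y)dw(Z) − |dw|² g(Y,Z)` for
  `A = Ric − (1/6) R g` — the law behind (1.20), (1.26)–(1.27) of Chang–Gursky–Yang 2003 and the
  `σ₂`-Yamabe equation of [CGY1].

Transport to the manifold exactly as `scalarCurvature_conformal_sq_four`: both metrics are pulled
back along the inverse chart at the point, where they differ by `e^{2 w∘Φ}`, and all terms are
natural (`ricci_comap_apply`, `scalarCurvature_comap`, `hessian_comap_apply`, `dalembertian_comap`,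
`innerDual_mvfderiv_comp`, `mvfderiv_comp_apply`). Everything is proved; no definition, no named
fact.

## References

* A. L. Besse, *Einstein Manifolds*, Springer 1987, Thm. 1.159 (b), (d), (e), (f) (p. 59: for
  `g¹ = e^{2f}g`, `r¹ = r − (n−2)(Ddf − df∘df) + (Δf − (n−2)|df|²)g`,
  `Z¹ = Z − (n−2)(Ddf − df∘df) − ((n−2)/n)(Δf + |df|²)g`,
  `s¹ = e^{−2f}(s + 2(n−1)Δf − (n−2)(n−1)|df|²)`, with `Δ = −tr Dd`, 1.54). [Besse1987]
* S.-Y. A. Chang, M. J. Gursky, P. C. Yang, *A conformally invariant sphere theorem in four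
  dimensions*, Publ. Math. IHÉS 98 (2003) 105–143, (0.1) p. 105, §1 p. 110 (`A = Ric − (1/6)Rg`),
  (1.20), (1.26)–(1.27) pp. 118–120. [ChangGurskyYang2003]
-/

noncomputable section

open Set Filter ContinuousLinearMap Module Function
open scoped Topology ContDiff Manifold

namespace Literature.Geometry.Lorentzian

/-! ### Coordinates: `c = e^{2u}`, `θ = du`, `H = Hess_G u` -/

namespace MetricCoord

variable {E : Type*} [NormedAddCommGroup E] [NormedSpace ℝ E]

section Exp

variable [FiniteDimensional ℝ E] [CompleteSpace E] {G : E → E →L[ℝ] E →L[ℝ] ℝ} {u : E → ℝ}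
  {V : Set E} {x : E}

omit [FiniteDimensional ℝ E] [CompleteSpace E] in
/-- For `c = e^{2u}`: `θ = dc/(2c) = du` (Besse 1987, Thm. 1.159: `g' = e^{2f} g`, `θ = df`).
[cite: Besse1987, Thm. 1.159] -/
theorem confForm_exp {y : E} (hu : DifferentiableAt ℝ u y) :
    confForm (fun z ↦ Real.exp (2 * u z)) y = fderiv ℝ u y := by
  have h2 : HasFDerivAt (fun z ↦ 2 * u z) ((2 : ℝ) • fderiv ℝ u y) y :=
    hu.hasFDerivAt.const_mul 2
  have hexp : fderiv ℝ (fun z ↦ Real.exp (2 * u z)) y =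
      Real.exp (2 * u y) • ((2 : ℝ) • fderiv ℝ u y) := h2.exp.fderiv
  rw [confForm, hexp, smul_smul, smul_smul]
  have hne : Real.exp (2 * u y) ≠ 0 := (Real.exp_pos _).ne'
  rw [show (2 * Real.exp (2 * u y))⁻¹ * Real.exp (2 * u y) * 2 = 1 by field_simp, one_smul]

omit [FiniteDimensional ℝ E] [CompleteSpace E] in
/-- For `c = e^{2u}` the derivative of `θ = du` is `D²u`. [folklore] -/
theorem IsMetricOn.fderiv_confForm_exp (hG : IsMetricOn G V) (hu : ContDiffOn ℝ ∞ u V)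
    (hx : x ∈ V) :
    fderiv ℝ (confForm (fun z ↦ Real.exp (2 * u z))) x = fderiv ℝ (fderiv ℝ u) x := by
  have heq : confForm (fun z ↦ Real.exp (2 * u z)) =ᶠ[𝓝 x] fderiv ℝ u :=
    (hG.eventually_mem hx).mono fun y hy ↦
      confForm_exp (hG.differentiableAt_of_contDiffOn hu hy)
  exact heq.fderiv_eq

omit [FiniteDimensional ℝ E] [CompleteSpace E] in
/-- For `c = e^{2u}`: the covariant Hessian of `f = ½ log c = u` is `H = Hess_G u` (`hessAt`).
[cite: Besse1987, Thm. 1.159] -/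
theorem IsMetricOn.confHess_exp (hG : IsMetricOn G V) (hu : ContDiffOn ℝ ∞ u V) (hx : x ∈ V) :
    confHess G (fun z ↦ Real.exp (2 * u z)) x = hessAt G u x := by
  ext v w
  rw [confHess_apply, hG.fderiv_confForm_exp hu hx,
    confForm_exp (hG.differentiableAt_of_contDiffOn hu hx), hessAt_apply]

/-- **The Ricci tensor of `e^{2u} G` in any dimension `n = dim E`** (Besse 1987, Thm. 1.159 (d):
`Ric' = Ric − (n−2)(∇df − df ∘ df) + (Δf − (n−2)|df|²) g` for `g' = e^{2f} g`, in Besse's sign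
`Δ = −tr ∇d`): with the coordinate Hessian `Hess_G u` (`hessAt`), Laplacian `Δ_G u = tr_G Hess_G u`
(`lapAt`, sign `tr ∇d`) and `|du|²_G = du(♯du)`,
`Ric'(Y,Z) = Ric(Y,Z) − (n−2)(Hess_G u (Y,Z) − du(Y) du(Z)) − (Δ_G u + (n−2)|du|²_G) G(Y,Z)`.
[cite: Besse1987, Thm. 1.159 (d)] -/
theorem IsMetricOn.ricAt_conformal_exp (hG : IsMetricOn G V) (hu : ContDiffOn ℝ ∞ u V)
    (hx : x ∈ V) (Y Z : E) :
    ricAt (fun y ↦ Real.exp (2 * u y) • G y) x Y Z =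
      ricAt G x Y Z
        - (Module.finrank ℝ E - 2 : ℝ) * (hessAt G u x Y Z - fderiv ℝ u x Y * fderiv ℝ u x Z)
        - (lapAt G u x + (Module.finrank ℝ E - 2 : ℝ) *
            fderiv ℝ u x (sharpAt G x (fderiv ℝ u x))) * G x Y Z := by
  have hc : ContDiffOn ℝ ∞ (fun z ↦ Real.exp (2 * u z)) V := (hu.const_smul (2 : ℝ)).exp.congr
    (fun y _ ↦ by simp [smul_eq_mul])
  have hc0 : ∀ y ∈ V, Real.exp (2 * u y) ≠ 0 := fun y _ ↦ (Real.exp_pos _).ne'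
  rw [hG.ricAt_conformal hc hc0 hx, hG.confHess_exp hu hx, confVec,
    confForm_exp (hG.differentiableAt_of_contDiffOn hu hx), ← lapAt]
  ring

/-- **The scalar curvature of `e^{2u} G` in any dimension `n = dim E`** (Besse 1987, Thm. 1.159 (f):
`S' = e^{−2f}(S + 2(n−1)Δf − (n−2)(n−1)|df|²)`, Besse's `Δ = −tr ∇d`):
`S' = e^{−2u}(S − 2(n−1) Δ_G u − (n−2)(n−1) |du|²_G)` with `Δ_G = tr_G Hess_G`.
[cite: Besse1987, Thm. 1.159 (f)] -/
theorem IsMetricOn.scalAt_conformal_exp (hG : IsMetricOn G V) (hu : ContDiffOn ℝ ∞ u V)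
    (hx : x ∈ V) :
    scalAt (fun y ↦ Real.exp (2 * u y) • G y) x =
      (Real.exp (2 * u x))⁻¹ * (scalAt G x - 2 * (Module.finrank ℝ E - 1 : ℝ) * lapAt G u x
        - (Module.finrank ℝ E - 2 : ℝ) * (Module.finrank ℝ E - 1 : ℝ) *
            fderiv ℝ u x (sharpAt G x (fderiv ℝ u x))) := by
  have hc : ContDiffOn ℝ ∞ (fun z ↦ Real.exp (2 * u z)) V := (hu.const_smul (2 : ℝ)).exp.congr
    (fun y _ ↦ by simp [smul_eq_mul])
  have hc0 : ∀ y ∈ V, Real.exp (2 * u y) ≠ 0 := fun y _ ↦ (Real.exp_pos _).ne'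
  rw [hG.scalAt_conformal hc hc0 hx, hG.confHess_exp hu hx, confVec,
    confForm_exp (hG.differentiableAt_of_contDiffOn hu hx), ← lapAt]

end Exp

end MetricCoord

/-! ### Metrics on an open subset of the model space -/

namespace OpensChart

variable {E : Type*} [NormedAddCommGroup E] [NormedSpace ℝ E] [FiniteDimensional ℝ E]
  [CompleteSpace E] {U : TopologicalSpace.Opens E}
  {g g' : PseudoRiemannianMetric 𝓘(ℝ, E) ∞ E (TangentSpace 𝓘(ℝ, E) : U → Type _)}
  {G : E → E →L[ℝ] E →L[ℝ] ℝ} (hG : ∀ y : U, g.val y = G y) {uE : E → ℝ}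
  (hG' : ∀ y : U, g'.val y = Real.exp (2 * uE y) • G y)

include hG in
omit [CompleteSpace E] in
/-- The inverse metric on covectors in the identity chart is `α(sharpAt G β)`. [folklore] -/
theorem innerDual_eq_sharpAt (x : U) (α β : E →L[ℝ] ℝ) :
    g.innerDual x (α : E →ₗ[ℝ] ℝ) (β : E →ₗ[ℝ] ℝ) = α (MetricCoord.sharpAt G x β) := by
  rw [PseudoRiemannianMetric.innerDual, sharp_eq_sharpAt hG x β]
  rfl

include hG hG' in
/-- **The Ricci tensor of `g' = e^{2w} g` on an open subset of the model space**, any dimension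
`n = dim E` (Besse 1987, Thm. 1.159 (d)), for the abstract `ricci`, `hessian`, `dalembertian`,
`innerDual` of `LeviCivita.lean` (through the dictionary of `ChartMetricCoord.lean` and
`MetricCoord.IsMetricOn.ricAt_conformal_exp`):
`Ric'(Y,Z) = Ric(Y,Z) − (n−2)(Hess w (Y,Z) − dw(Y)dw(Z)) − (Δ w + (n−2) g⁻¹(dw,dw)) g(Y,Z)`.
[cite: Besse1987, Thm. 1.159 (d)] -/
theorem ricci_conformalRepr_exp [g.HasLeviCivita] [g'.HasLeviCivita]
    (hu : ContDiffOn ℝ ∞ uE (U : Set E)) {w : U → ℝ} (hw : ∀ y : U, w y = uE y) (x : U) (Y Z : E) :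
    g'.ricci x Y Z =
      g.ricci x Y Z
        - (finrank ℝ E - 2 : ℝ) *
            (g.hessian w x Y Z - mvfderiv 𝓘(ℝ, E) w x Y * mvfderiv 𝓘(ℝ, E) w x Z)
        - (g.dalembertian w x + (finrank ℝ E - 2 : ℝ) *
            g.innerDual x (mvfderiv 𝓘(ℝ, E) w x).toLinearMap (mvfderiv 𝓘(ℝ, E) w x).toLinearMap) *
          g.val x Y Z := by
  have hmet : MetricCoord.IsMetricOn G (U : Set E) := isMetricOn_repr hG
  have hux : ContDiffAt ℝ 2 uE x :=
    (hu.contDiffAt (U.2.mem_nhds x.2)).of_le (WithTop.coe_le_coe.mpr le_top)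
  have hdiff : DifferentiableAt ℝ uE x := hux.differentiableAt (by simp)
  have hmv : mvfderiv 𝓘(ℝ, E) w x = fderiv ℝ uE x := by
    ext v
    exact mvfderiv_eq x w uE hw hdiff v
  rw [ricci_eq_ricAt (G := fun y ↦ Real.exp (2 * uE y) • G y) hG' x, ricci_eq_ricAt hG x,
    hessian_eq_hessAt hG x hw hux, dalembertian_eq_lapAt hG x hw hux, hmv,
    innerDual_eq_sharpAt hG x, hG x, hmet.ricAt_conformal_exp hu x.2 Y Z]
  rfl

include hG hG' in
/-- **The scalar curvature of `g' = e^{2w} g` on an open subset of the model space**, any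
dimension `n` (Besse 1987, Thm. 1.159 (f)):
`S' = e^{−2w}(S − 2(n−1) Δw − (n−2)(n−1) g⁻¹(dw,dw))`. [cite: Besse1987, Thm. 1.159 (f)] -/
theorem scalarCurvature_conformalRepr_exp [g.HasLeviCivita] [g'.HasLeviCivita]
    (hu : ContDiffOn ℝ ∞ uE (U : Set E)) {w : U → ℝ} (hw : ∀ y : U, w y = uE y) (x : U) :
    g'.scalarCurvature x =
      (Real.exp (2 * w x))⁻¹ * (g.scalarCurvature x
        - 2 * (finrank ℝ E - 1 : ℝ) * g.dalembertian w x
        - (finrank ℝ E - 2 : ℝ) * (finrank ℝ E - 1 : ℝ) *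
            g.innerDual x (mvfderiv 𝓘(ℝ, E) w x).toLinearMap (mvfderiv 𝓘(ℝ, E) w x).toLinearMap) := by
  have hmet : MetricCoord.IsMetricOn G (U : Set E) := isMetricOn_repr hG
  have hux : ContDiffAt ℝ 2 uE x :=
    (hu.contDiffAt (U.2.mem_nhds x.2)).of_le (WithTop.coe_le_coe.mpr le_top)
  have hdiff : DifferentiableAt ℝ uE x := hux.differentiableAt (by simp)
  have hmv : mvfderiv 𝓘(ℝ, E) w x = fderiv ℝ uE x := by
    ext v
    exact mvfderiv_eq x w uE hw hdiff v
  rw [scalarCurvature_eq_scalAt (G := fun y ↦ Real.exp (2 * uE y) • G y) hG' x,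
    scalarCurvature_eq_scalAt hG x, dalembertian_eq_lapAt hG x hw hux, hmv,
    innerDual_eq_sharpAt hG x, hw x, hmet.scalAt_conformal_exp hu x.2]

end OpensChart

/-! ### The laws on a manifold modelled on its model vector space -/

namespace PseudoRiemannianMetric

variable {E : Type*} [NormedAddCommGroup E] [NormedSpace ℝ E] [FiniteDimensional ℝ E]
  [CompleteSpace E] {X : Type*} [TopologicalSpace X] [ChartedSpace E X] [IsManifold 𝓘(ℝ, E) ∞ X]
  (g g' : PseudoRiemannianMetric 𝓘(ℝ, E) ∞ E (TangentSpace 𝓘(ℝ, E) : X → Type _))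
  [g.HasLeviCivita] [g'.HasLeviCivita] {w : X → ℝ}

/-- **The Ricci tensor of a conformal metric `g' = e^{2w} g`** on a manifold modelled on a vector
space `E` of any dimension `n` (charts into `E` itself), `g, g'` smooth with their Levi-Civita
connections, `w` smooth (Besse 1987, Thm. 1.159 (d): `r' = r − (n−2)(Ddf − df ∘ df) +
(Δf − (n−2)|df|²) g` with `Δ = −tr Dd`): at every point and for all `Y, Z`,
`Ric'(Y,Z) = Ric(Y,Z) − (n−2)(Hess_g w (Y,Z) − dw(Y) dw(Z)) − (Δ_g w + (n−2) g⁻¹(dw,dw)) g(Y,Z)`,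
with `Hess_g = hessian`, `Δ_g = tr_g Hess = dalembertian`, `g⁻¹ = innerDual`, `dw = mvfderiv`.
Proof: pull both metrics back along the inverse chart at the point (`ricci_comap_apply`,
`hessian_comap_apply`, `dalembertian_comap`, `innerDual_mvfderiv_comp`, `mvfderiv_comp_apply`),
where they differ by `e^{2 w∘Φ}` and the law is `OpensChart.ricci_conformalRepr_exp`.
[cite: Besse1987, Thm. 1.159 (d)] -/
theorem ricci_conformal_exp (hw : ContMDiff 𝓘(ℝ, E) 𝓘(ℝ) ∞ w)
    (hgg' : ∀ (x : X) (v v' : TangentSpace 𝓘(ℝ, E) x), g'.val x v v' = Real.exp (2 * w x) * g.val x v v')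
    (x : X) (Y Z : TangentSpace 𝓘(ℝ, E) x) :
    g'.ricci x Y Z =
      g.ricci x Y Z
        - (finrank ℝ E - 2 : ℝ) *
            (g.hessian w x Y Z - mvfderiv 𝓘(ℝ, E) w x Y * mvfderiv 𝓘(ℝ, E) w x Z)
        - (g.dalembertian w x + (finrank ℝ E - 2 : ℝ) *
            g.innerDual x (mvfderiv 𝓘(ℝ, E) w x).toLinearMap (mvfderiv 𝓘(ℝ, E) w x).toLinearMap) *
          g.val x Y Z := by
  -- the inverse chart at `x`
  set U : TopologicalSpace.Opens E := ⟨(chartAt E x).target, (chartAt E x).open_target⟩ with hU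
  set Φ : U → X := fun u ↦ (chartAt E x).symm u with hΦdef
  have hΦ : ContMDiff 𝓘(ℝ, E) 𝓘(ℝ, E) (∞ + 1) Φ := ChartInverseSelf.contMDiff_symm x
  have hΦ' : ∀ u, Function.Injective (mfderiv 𝓘(ℝ, E) 𝓘(ℝ, E) Φ u) :=
    ChartInverseSelf.injective_mfderiv_symm x
  have hdim : Module.finrank ℝ E = Module.finrank ℝ E := rfl
  have hpb : contMDiff_pullbackBilin 𝓘(ℝ, E) X 𝓘(ℝ, E) U ∞ := contMDiff_pullbackBilin_holds
  set u₀ : U := ⟨chartAt E x x, (chartAt E x).map_source (mem_chart_source E x)⟩ with hu₀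
  have hx : Φ u₀ = x := (chartAt E x).left_inv (mem_chart_source E x)
  -- the pulled-back metrics on `U`
  set gU := g.comap hpb Φ hΦ hΦ' hdim with hgU
  set gU' := g'.comap hpb Φ hΦ hΦ' hdim with hgU'
  haveI : gU.HasLeviCivita := gU.hasLeviCivita
  haveI : gU'.HasLeviCivita := gU'.hasLeviCivita
  -- representatives on `E`
  set G : E → E →L[ℝ] E →L[ℝ] ℝ := Function.extend (Subtype.val : U → E)
    (fun y : U ↦ (gU.val y : E →L[ℝ] E →L[ℝ] ℝ)) (fun _ ↦ 0) with hGdef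
  set wE : E → ℝ := fun y ↦ w ((chartAt E x).symm y) with hwEdef
  have hG : ∀ y : U, gU.val y = G y := fun y ↦ by
    rw [hGdef, Subtype.val_injective.extend_apply]
  have hwy : ∀ y : U, (w ∘ Φ) y = wE y := fun y ↦ rfl
  have hG' : ∀ y : U, gU'.val y = Real.exp (2 * wE y) • G y := by
    intro y
    ext v v'
    change g'.val (Φ y) (mfderiv 𝓘(ℝ, E) 𝓘(ℝ, E) Φ y v) (mfderiv 𝓘(ℝ, E) 𝓘(ℝ, E) Φ y v') =
      Real.exp (2 * wE y) * G y v v'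
    rw [hgg', ← hG y]
    rfl
  have hws : ContDiffOn ℝ ∞ wE (U : Set E) := fun y hy ↦
    (ChartInverseSelf.contDiffAt_comp_symm x hw hy).contDiffWithinAt
  -- the chart computation on `U`
  have key := OpensChart.ricci_conformalRepr_exp hG (g' := gU') hG' hws hwy u₀
  -- move the point to `Φ u₀` and the vectors to images under `dΦ`
  revert Y Z
  rw [← hx]
  intro Y Z
  set e := mfderivEquivOfInjective (I := 𝓘(ℝ, E)) (I' := 𝓘(ℝ, E)) Φ u₀ (hΦ' u₀) hdim with he
  obtain ⟨Y', rfl⟩ : ∃ Y', mfderiv 𝓘(ℝ, E) 𝓘(ℝ, E) Φ u₀ Y' = Y :=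
    ⟨e.symm Y, mfderiv_mfderivEquivOfInjective_symm _ _ _ _ Y⟩
  obtain ⟨Z', rfl⟩ : ∃ Z', mfderiv 𝓘(ℝ, E) 𝓘(ℝ, E) Φ u₀ Z' = Z :=
    ⟨e.symm Z, mfderiv_mfderivEquivOfInjective_symm _ _ _ _ Z⟩
  -- naturality of every term
  have h2 : (2 : ℕ∞ω) ≤ ∞ := WithTop.coe_le_coe.mpr le_top
  have hw2 : ContMDiffAt 𝓘(ℝ, E) 𝓘(ℝ) 2 w (Φ u₀) := (hw.of_le h2) _
  have hwd : MDifferentiableAt 𝓘(ℝ, E) 𝓘(ℝ, ℝ) w (Φ u₀) := hw2.mdifferentiableAt (by simp)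
  have hΦd : MDifferentiableAt 𝓘(ℝ, E) 𝓘(ℝ, E) Φ u₀ :=
    ((hΦ.of_le le_self_add) u₀).mdifferentiableAt (by simp)
  rw [← g'.ricci_comap_apply hpb hΦ hΦ' hdim u₀, ← g.ricci_comap_apply hpb hΦ hΦ' hdim u₀,
    ← g.hessian_comap_apply hpb hΦ hΦ' hdim hw2, ← g.dalembertian_comap hpb hΦ hΦ' hdim hw2,
    ← g.innerDual_mvfderiv_comp hpb hΦ hΦ' hdim u₀ hwd hwd,
    ← mvfderiv_comp_apply hwd hΦd, ← mvfderiv_comp_apply hwd hΦd]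
  have hval : g.val (Φ u₀) (mfderiv 𝓘(ℝ, E) 𝓘(ℝ, E) Φ u₀ Y') (mfderiv 𝓘(ℝ, E) 𝓘(ℝ, E) Φ u₀ Z') =
      gU.val u₀ Y' Z' := by
    rw [hgU, val_comap, pullbackBilin_apply]
  rw [hval]
  exact key Y' Z'

/-- **The scalar curvature of a conformal metric `g' = e^{2w} g`** on a manifold modelled on a
vector space `E` of any dimension `n` (Besse 1987, Thm. 1.159 (f):
`s' = e^{−2f}(s + 2(n−1)Δf − (n−2)(n−1)|df|²)`, `Δ = −tr Dd`):
`S' = e^{−2w}(S − 2(n−1) Δ_g w − (n−2)(n−1) g⁻¹(dw,dw))` with `Δ_g = dalembertian = tr_g Hess`.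
(The tree had the `ψ²`-form in dimension `4`, `scalarCurvature_conformal_sq_four`, and the
`ψ⁴`-form in dimension `3`.) [cite: Besse1987, Thm. 1.159 (f)] -/
theorem scalarCurvature_conformal_exp (hw : ContMDiff 𝓘(ℝ, E) 𝓘(ℝ) ∞ w)
    (hgg' : ∀ (x : X) (v v' : TangentSpace 𝓘(ℝ, E) x), g'.val x v v' = Real.exp (2 * w x) * g.val x v v')
    (x : X) :
    g'.scalarCurvature x =
      (Real.exp (2 * w x))⁻¹ * (g.scalarCurvature x
        - 2 * (finrank ℝ E - 1 : ℝ) * g.dalembertian w x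
        - (finrank ℝ E - 2 : ℝ) * (finrank ℝ E - 1 : ℝ) *
            g.innerDual x (mvfderiv 𝓘(ℝ, E) w x).toLinearMap (mvfderiv 𝓘(ℝ, E) w x).toLinearMap) := by
  -- the inverse chart at `x`
  set U : TopologicalSpace.Opens E := ⟨(chartAt E x).target, (chartAt E x).open_target⟩ with hU
  set Φ : U → X := fun u ↦ (chartAt E x).symm u with hΦdef
  have hΦ : ContMDiff 𝓘(ℝ, E) 𝓘(ℝ, E) (∞ + 1) Φ := ChartInverseSelf.contMDiff_symm x
  have hΦ' : ∀ u, Function.Injective (mfderiv 𝓘(ℝ, E) 𝓘(ℝ, E) Φ u) :=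
    ChartInverseSelf.injective_mfderiv_symm x
  have hdim : Module.finrank ℝ E = Module.finrank ℝ E := rfl
  have hpb : contMDiff_pullbackBilin 𝓘(ℝ, E) X 𝓘(ℝ, E) U ∞ := contMDiff_pullbackBilin_holds
  set u₀ : U := ⟨chartAt E x x, (chartAt E x).map_source (mem_chart_source E x)⟩ with hu₀
  have hx : Φ u₀ = x := (chartAt E x).left_inv (mem_chart_source E x)
  set gU := g.comap hpb Φ hΦ hΦ' hdim with hgU
  set gU' := g'.comap hpb Φ hΦ hΦ' hdim with hgU'
  haveI : gU.HasLeviCivita := gU.hasLeviCivita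
  haveI : gU'.HasLeviCivita := gU'.hasLeviCivita
  set G : E → E →L[ℝ] E →L[ℝ] ℝ := Function.extend (Subtype.val : U → E)
    (fun y : U ↦ (gU.val y : E →L[ℝ] E →L[ℝ] ℝ)) (fun _ ↦ 0) with hGdef
  set wE : E → ℝ := fun y ↦ w ((chartAt E x).symm y) with hwEdef
  have hG : ∀ y : U, gU.val y = G y := fun y ↦ by
    rw [hGdef, Subtype.val_injective.extend_apply]
  have hwy : ∀ y : U, (w ∘ Φ) y = wE y := fun y ↦ rfl
  have hG' : ∀ y : U, gU'.val y = Real.exp (2 * wE y) • G y := by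
    intro y
    ext v v'
    change g'.val (Φ y) (mfderiv 𝓘(ℝ, E) 𝓘(ℝ, E) Φ y v) (mfderiv 𝓘(ℝ, E) 𝓘(ℝ, E) Φ y v') =
      Real.exp (2 * wE y) * G y v v'
    rw [hgg', ← hG y]
    rfl
  have hws : ContDiffOn ℝ ∞ wE (U : Set E) := fun y hy ↦
    (ChartInverseSelf.contDiffAt_comp_symm x hw hy).contDiffWithinAt
  have key := OpensChart.scalarCurvature_conformalRepr_exp hG (g' := gU') hG' hws hwy u₀
  have h2 : (2 : ℕ∞ω) ≤ ∞ := WithTop.coe_le_coe.mpr le_top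
  have hw2 : ContMDiffAt 𝓘(ℝ, E) 𝓘(ℝ) 2 w (Φ u₀) := (hw.of_le h2) _
  have hwd : MDifferentiableAt 𝓘(ℝ, E) 𝓘(ℝ, ℝ) w (Φ u₀) := hw2.mdifferentiableAt (by simp)
  rw [← hx, ← g'.scalarCurvature_comap hpb hΦ hΦ' hdim u₀, ← g.scalarCurvature_comap hpb hΦ hΦ' hdim u₀,
    ← g.dalembertian_comap hpb hΦ hΦ' hdim hw2, ← g.innerDual_mvfderiv_comp hpb hΦ hΦ' hdim u₀ hwd hwd]
  exact key

/-- **The trace-free Ricci tensor `Z = Ric − (R/n) g` of a conformal metric `g' = e^{2w} g`**, any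
dimension `n ≥ 1` (Besse 1987, Thm. 1.159 (e): `Z¹ = Z − (n−2)(Ddf − df∘df) − ((n−2)/n)(Δf + |df|²)g`
with `Δ = −tr Dd`): `Z'(Y,Z) = Z(Y,Z) − (n−2)(Hess w (Y,Z) − dw(Y)dw(Z)) + ((n−2)/n)(Δ_g w − |dw|²) g(Y,Z)`,
where `Z'(Y,Z) = Ric'(Y,Z) − (R'/n) g'(Y,Z)`, `g' = e^{2w} g`. [cite: Besse1987, Thm. 1.159 (e)] -/
theorem tracelessRicciForm_conformal_exp (hn : finrank ℝ E ≠ 0) (hw : ContMDiff 𝓘(ℝ, E) 𝓘(ℝ) ∞ w)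
    (hgg' : ∀ (x : X) (v v' : TangentSpace 𝓘(ℝ, E) x), g'.val x v v' = Real.exp (2 * w x) * g.val x v v')
    (x : X) (Y Z : TangentSpace 𝓘(ℝ, E) x) :
    g'.ricci x Y Z - g'.scalarCurvature x / finrank ℝ E * g'.val x Y Z =
      (g.ricci x Y Z - g.scalarCurvature x / finrank ℝ E * g.val x Y Z)
        - (finrank ℝ E - 2 : ℝ) *
            (g.hessian w x Y Z - mvfderiv 𝓘(ℝ, E) w x Y * mvfderiv 𝓘(ℝ, E) w x Z)
        + (finrank ℝ E - 2 : ℝ) / finrank ℝ E * (g.dalembertian w x -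
            g.innerDual x (mvfderiv 𝓘(ℝ, E) w x).toLinearMap (mvfderiv 𝓘(ℝ, E) w x).toLinearMap) *
          g.val x Y Z := by
  have hne : Real.exp (2 * w x) ≠ 0 := (Real.exp_pos _).ne'
  have hn' : (finrank ℝ E : ℝ) ≠ 0 := Nat.cast_ne_zero.mpr hn
  rw [g.ricci_conformal_exp g' hw hgg' x Y Z, g.scalarCurvature_conformal_exp g' hw hgg' x, hgg' x Y Z]
  field_simp
  ring

/-! ### Dimension four: the formulas of conformal geometry used by Chang–Gursky–Yang -/

/-- **`Ric'` in dimension four**: for `g' = e^{2w} g` on a manifold modelled on a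
`4`-dimensional space, `Ric'(Y,Z) = Ric(Y,Z) − 2(Hess w (Y,Z) − dw(Y)dw(Z)) − (Δw + 2|dw|²) g(Y,Z)`
(Besse 1987, Thm. 1.159 (d) at `n = 4`). [cite: Besse1987, Thm. 1.159 (d)] -/
theorem ricci_conformal_exp_four (h4 : finrank ℝ E = 4) (hw : ContMDiff 𝓘(ℝ, E) 𝓘(ℝ) ∞ w)
    (hgg' : ∀ (x : X) (v v' : TangentSpace 𝓘(ℝ, E) x), g'.val x v v' = Real.exp (2 * w x) * g.val x v v')
    (x : X) (Y Z : TangentSpace 𝓘(ℝ, E) x) :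
    g'.ricci x Y Z =
      g.ricci x Y Z - 2 * (g.hessian w x Y Z - mvfderiv 𝓘(ℝ, E) w x Y * mvfderiv 𝓘(ℝ, E) w x Z)
        - (g.dalembertian w x +
            2 * g.innerDual x (mvfderiv 𝓘(ℝ, E) w x).toLinearMap (mvfderiv 𝓘(ℝ, E) w x).toLinearMap) *
          g.val x Y Z := by
  rw [g.ricci_conformal_exp g' hw hgg' x Y Z, h4]
  norm_num

/-- **`R'` in dimension four**: `R' = e^{−2w}(R − 6Δw − 6|dw|²)` for `g' = e^{2w} g`
(Besse 1987, Thm. 1.159 (f) at `n = 4`; with `ψ = e^w` this is `R' = ψ⁻³(Rψ − 6Δψ)`,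
`scalarCurvature_conformal_sq_four`). [cite: Besse1987, Thm. 1.159 (f)] -/
theorem scalarCurvature_conformal_exp_four (h4 : finrank ℝ E = 4) (hw : ContMDiff 𝓘(ℝ, E) 𝓘(ℝ) ∞ w)
    (hgg' : ∀ (x : X) (v v' : TangentSpace 𝓘(ℝ, E) x), g'.val x v v' = Real.exp (2 * w x) * g.val x v v')
    (x : X) :
    g'.scalarCurvature x =
      (Real.exp (2 * w x))⁻¹ * (g.scalarCurvature x - 6 * g.dalembertian w x
        - 6 * g.innerDual x (mvfderiv 𝓘(ℝ, E) w x).toLinearMap (mvfderiv 𝓘(ℝ, E) w x).toLinearMap) := by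
  rw [g.scalarCurvature_conformal_exp g' hw hgg' x, h4]
  norm_num

/-- **The Weyl–Schouten tensor `A = Ric − (1/6) R g` of a conformal metric in dimension four**
(Chang–Gursky–Yang 2003, §1, p. 110: "the Weyl–Schouten tensor `A = Ric − (1/6)Rg`";
the transformation law underlying the `σ₂`-equations (1.20), (1.26)–(1.27) and [CGY1]):
for `g' = e^{2w} g`,
`A'(Y,Z) = A(Y,Z) − 2 Hess w (Y,Z) + 2 dw(Y) dw(Z) − |dw|²_g g(Y,Z)`,
where `A'(Y,Z) = Ric'(Y,Z) − (1/6) R' g'(Y,Z)` and `g'(Y,Z) = e^{2w} g(Y,Z)` — from Besse 1987,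
Thm. 1.159 (d), (f) at `n = 4`. [cite: ChangGurskyYang2003, §1, p. 110]
[cite: Besse1987, Thm. 1.159 (d) and (f)] -/
theorem weylSchouten_conformal_exp_four (h4 : finrank ℝ E = 4) (hw : ContMDiff 𝓘(ℝ, E) 𝓘(ℝ) ∞ w)
    (hgg' : ∀ (x : X) (v v' : TangentSpace 𝓘(ℝ, E) x), g'.val x v v' = Real.exp (2 * w x) * g.val x v v')
    (x : X) (Y Z : TangentSpace 𝓘(ℝ, E) x) :
    g'.ricci x Y Z - g'.scalarCurvature x / 6 * g'.val x Y Z =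
      (g.ricci x Y Z - g.scalarCurvature x / 6 * g.val x Y Z)
        - 2 * g.hessian w x Y Z + 2 * (mvfderiv 𝓘(ℝ, E) w x Y * mvfderiv 𝓘(ℝ, E) w x Z)
        - g.innerDual x (mvfderiv 𝓘(ℝ, E) w x).toLinearMap (mvfderiv 𝓘(ℝ, E) w x).toLinearMap *
          g.val x Y Z := by
  have hne : Real.exp (2 * w x) ≠ 0 := (Real.exp_pos _).ne'
  rw [g.ricci_conformal_exp_four g' h4 hw hgg' x Y Z, g.scalarCurvature_conformal_exp_four g' h4 hw hgg' x,
    hgg' x Y Z]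
  field_simp
  ring

/-- **The trace-free Ricci tensor `E = Ric − ¼ R g` of a conformal metric in dimension four**
(Chang–Gursky–Yang 2003, (0.1): `E = Ric − ¼Rg`): for `g' = e^{2w} g`,
`E'(Y,Z) = E(Y,Z) − 2(Hess w (Y,Z) − dw(Y)dw(Z)) + ½(Δw − |dw|²) g(Y,Z)` — i.e. `E' = E − 2` (the
trace-free part of `Hess w − dw ⊗ dw`), with `E'(Y,Z) = Ric'(Y,Z) − ¼ R' g'(Y,Z)`,
`g' = e^{2w} g`. [cite: ChangGurskyYang2003, (0.1)] [cite: Besse1987, Thm. 1.159 (d) and (f)] -/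
theorem tracelessRicciForm_conformal_exp_four (h4 : finrank ℝ E = 4)
    (hw : ContMDiff 𝓘(ℝ, E) 𝓘(ℝ) ∞ w)
    (hgg' : ∀ (x : X) (v v' : TangentSpace 𝓘(ℝ, E) x), g'.val x v v' = Real.exp (2 * w x) * g.val x v v')
    (x : X) (Y Z : TangentSpace 𝓘(ℝ, E) x) :
    g'.ricci x Y Z - g'.scalarCurvature x / 4 * g'.val x Y Z =
      (g.ricci x Y Z - g.scalarCurvature x / 4 * g.val x Y Z)
        - 2 * (g.hessian w x Y Z - mvfderiv 𝓘(ℝ, E) w x Y * mvfderiv 𝓘(ℝ, E) w x Z)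
        + 1 / 2 * (g.dalembertian w x -
            g.innerDual x (mvfderiv 𝓘(ℝ, E) w x).toLinearMap (mvfderiv 𝓘(ℝ, E) w x).toLinearMap) *
          g.val x Y Z := by
  have hne : Real.exp (2 * w x) ≠ 0 := (Real.exp_pos _).ne'
  rw [g.ricci_conformal_exp_four g' h4 hw hgg' x Y Z, g.scalarCurvature_conformal_exp_four g' h4 hw hgg' x,
    hgg' x Y Z]
  field_simp
  ring

end PseudoRiemannianMetric

end Literature.Geometry.Lorentzian

end
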